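import Summits.QuantumFields.YangMills.Theses.UnitScaleTilt
import Summits.QuantumFields.YangMills.Theorems.UnitScaleTiltHistoryTailStokesStep

/-!
# Route `UnitScaleTilt` — crux K2 `HistoryTail` (stmt-QuantumFields-18916): THE ITERATED (69)–(70) FOR THE ROUTE'S AVERAGING ALONG NESTED
# REGIONS — `Σ_{R_j}|Ū^{j}(∂p′) − 1|² ≤ Π_{s<j}((1+ε_s)Λ)·Σ_{R_0}|U(∂q) − 1|² + Σ_{s<j} Π_{s<u<j}((1+ε_u)Λ)·#R_{s+1}(1+ε_s⁻¹)(435t_s²)²`,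
# `Λ = L⁴/L^d` (support file; brick S3b of sub-lemma S3 of the split card)

Fleet lead `ym-ust-18916-p1` (gen 0); split card `CARD-18916-K2-split.md` (evidence #12), sub-lemma **S3** (the numerator small factor of
mechanism A), brick **S3b** = the iteration of the one-step local Stokes–Jensen inequality S3a (`HistoryTailStokesStep.sum_dist1_sq_avgFun_le`,
p442112) down a tower of NESTED REGIONS `R_j ⊇… ⊇ R_0` (`R_s` a finite set of level-`s` plaquettes containing the translated squares under
`R_{s+1}`; for the per-plaquette argument `R_j = {p′}` and `R_0 = Δ′(p′)`, the fine plaquettes under `p′`, [Balaban1985UV3] (69)–(70) p.273),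
under a REGULARITY PROFILE `a_s` of the intermediate averaged fields `Ū^{s}` (print's (68): the composite minimiser is regular at every scale
below a regular plaquette; here a hypothesis `PlaqSmall (a s) (Ū^{s})` per level, GLOBAL as in S3a).  The per-step factor is `(1+ε_s)·Λ`,
`Λ = L⁴(L^d)⁻¹` (`= L` in `d = 3`, the ratio of consecutive bare couplings): with `Σε_s < ∞` the product stays bounded UNIFORMLY IN `j` — the
point of the (69)–(70) route versus the sup-norm iteration of p438760.

* `seq_bound_of_step` — the elementary recursion `E_{s+1} ≤ α_s E_s + c_s ⇒ E_j ≤ (Π_{s<j}α_s)E_0 + Σ_{s<j}(Π_{s<u<j}α_u)c_s` (`α ≥ 0`);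
* `iter_sum_dist1_sq_le` — the displayed inequality for the `j`-fold (0.4)+`exp[mean log]` average on `SU(N)`, every `d`, every profile
  `(a_s, ε_s)` with `t_s = ((d+2)L)²a_s/4 ≤ 1/10`, `t_s < δ_N`, `ε_s > 0`, in the standing range `j ≤ m + K`.

WHAT THIS IS NOT: not (71) (S3c: the choice `ε_s`, the regularity profile (68) `a_s ≍ g p(g)L^{2(s−j)}`, and `β_{K−j}θ(K−j)² = p(g_{K−j})²`), not
the localisation of the smallness hypotheses, nothing of (41)/(47), nothing uses (α).
-/

noncomputable section

open scoped BigOperators Matrix.Norms.L2Operator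

namespace Summit.QuantumFields.YangMills.Theorems.HistoryTailStokesIter

open Literature.MathematicalPhysics.QuantumFieldTheory.Balaban1983to89
open T4Continuum BlockAveraging AveragingRT ExpMeanLog BlockAveragingPlaquetteBound
open B10Eq47AxialChi (shiftN)
open Summit.QuantumFields.YangMills.Theorems.HistoryTailStokesStep (sum_dist1_sq_avgFun_le)

/-! ## §1 The elementary recursion -/

/-- **`E_{s+1} ≤ α_s E_s + c_s` for `s < j`, `α ≥ 0` ⇒ `E_j ≤ (Π_{s<j} α_s)·E_0 + Σ_{s<j} (Π_{u∈(s,j)} α_u)·c_s`.** [folklore] -/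
theorem seq_bound_of_step (E α c : ℕ → ℝ) (hα : ∀ s, 0 ≤ α s) :
    ∀ j : ℕ, (∀ s, s < j → E (s + 1) ≤ α s * E s + c s) →
      E j ≤ (∏ s ∈ Finset.range j, α s) * E 0 + ∑ s ∈ Finset.range j, (∏ u ∈ Finset.Ico (s + 1) j, α u) * c s
  | 0, _ => by simp
  | j + 1, h => by
    have hprev := seq_bound_of_step E α c hα j fun s hs => h s (Nat.lt_succ_of_lt hs)
    have hstep := h j (Nat.lt_succ_self j)
    have hmul := mul_le_mul_of_nonneg_left hprev (hα j)
    -- rewrite the target's products and sums at `j + 1`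
    rw [Finset.prod_range_succ, Finset.sum_range_succ, Finset.Ico_self, Finset.prod_empty, one_mul]
    have hIco : ∀ s ∈ Finset.range j, (∏ u ∈ Finset.Ico (s + 1) (j + 1), α u) = α j * ∏ u ∈ Finset.Ico (s + 1) j, α u := by
      intro s hs
      rw [Finset.mem_range] at hs
      rw [Finset.prod_Ico_succ_top (by omega : s + 1 ≤ j), mul_comm]
    rw [Finset.sum_congr rfl fun s hs => by rw [hIco s hs]]
    have hsum : ∑ s ∈ Finset.range j, α j * (∏ u ∈ Finset.Ico (s + 1) j, α u) * c s =
        α j * ∑ s ∈ Finset.range j, (∏ u ∈ Finset.Ico (s + 1) j, α u) * c s := by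
      rw [Finset.mul_sum]
      exact Finset.sum_congr rfl fun s _ => by ring
    rw [hsum]
    calc E (j + 1) ≤ α j * E j + c j := hstep
      _ ≤ α j * ((∏ s ∈ Finset.range j, α s) * E 0 + ∑ s ∈ Finset.range j, (∏ u ∈ Finset.Ico (s + 1) j, α u) * c s) + c j :=
          by linarith [hmul]
      _ = (∏ s ∈ Finset.range j, α s) * α j * E 0 +
            (α j * ∑ s ∈ Finset.range j, (∏ u ∈ Finset.Ico (s + 1) j, α u) * c s + c j) := by ring

/-! ## §2 The iterated local Stokes–Jensen inequality along nested regions -/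

section Iter

variable {n : Type*} [Fintype n] [DecidableEq n] [Nonempty n] {P : Params}

/-- `Ū^{s+1} = avgFun ℰ (Ū^{s})` (the iterate's successor step, definitional). [cite: Balaban1987RG1, (0.11) p.253] -/
theorem iter_succ_eq (ℰ : LoopAverage (Matrix.specialUnitaryGroup n ℂ)) (s : ℕ)
    (U : GaugeField P 0 (Matrix.specialUnitaryGroup n ℂ)) :
    Averaging.iter (fun _ => BlockAveraging.blockAvg ℰ) (s + 1) U =
      avgFun ℰ (Averaging.iter (fun _ => BlockAveraging.blockAvg ℰ) s U) := rfl

/-- **THE ITERATED (69)–(70) FOR THE ROUTE'S AVERAGING ALONG NESTED REGIONS** (`SU(N)`, every `d`, standing range `j ≤ m + K`): with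
`Ū^{s}` the `s`-fold (0.4)+`exp[mean log]` average of `U`, a regularity profile `PlaqSmall (a_s) Ū^{s}` (`t_s = ((d+2)L)²a_s/4 ≤ 1/10`,
`t_s < δ_N`), weights `ε_s > 0`, and finite regions `R_s` of level-`s` plaquettes with the translated squares under `R_{s+1}` inside `R_s`,
`Σ_{p∈R_j}|Ū^{j}(∂p) − 1|² ≤ (Π_{s<j}(1+ε_s)Λ)·Σ_{q∈R_0}|U(∂q) − 1|² + Σ_{s<j}(Π_{s<u<j}(1+ε_u)Λ)·#R_{s+1}·(1+ε_s⁻¹)·(435t_s²)²`, `Λ = L⁴(L^d)⁻¹`.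
[cite: Balaban1985UV3, (69)-(70) p.273; Balaban1987RG1, (0.4) p.253] -/
theorem iter_sum_dist1_sq_le (U : GaugeField P 0 (Matrix.specialUnitaryGroup n ℂ)) (a ε : ℕ → ℝ)
    (R : (s : ℕ) → Finset (Plaq P s)) (j : ℕ) (hj : j ≤ P.m + P.K)
    (ha : ∀ s, s < j → 0 ≤ a s)
    (hU : ∀ s, s < j → PlaqSmall (a s) (Averaging.iter (fun _ => BlockAveraging.blockAvg (expMeanLogSU (n := n))) s U))
    (ht : ∀ s, s < j → ((((P.d + 2) * P.L : ℕ) : ℝ) ^ 2 / 4) * a s ≤ 1 / 10)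
    (hδ : ∀ s, s < j → ((((P.d + 2) * P.L : ℕ) : ℝ) ^ 2 / 4) * a s < deltaSU n)
    (hε : ∀ s, 0 < ε s)
    (hR : ∀ s, s < j → ∀ p ∈ R (s + 1), ∀ (r : Fin P.d → Fin P.L), ∀ t ∈ Finset.range P.L, ∀ s' ∈ Finset.range P.L,
      (⟨shiftN (shiftN (Site.blockSite p.src r) p.ν t) p.μ s', p.μ, p.ν, p.hμν⟩ : Plaq P s) ∈ R s) :
    ∑ p ∈ R j, dist1 (GaugeField.plaqHol (Averaging.iter (fun _ => BlockAveraging.blockAvg (expMeanLogSU (n := n))) j U) p) ^ 2 ≤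
      (∏ s ∈ Finset.range j, ((1 + ε s) * ((P.L : ℝ) ^ 4 * ((P.L : ℝ) ^ P.d)⁻¹))) *
          ∑ q ∈ R 0, dist1 (GaugeField.plaqHol U q) ^ 2 +
        ∑ s ∈ Finset.range j, (∏ u ∈ Finset.Ico (s + 1) j, ((1 + ε u) * ((P.L : ℝ) ^ 4 * ((P.L : ℝ) ^ P.d)⁻¹))) *
          ((R (s + 1)).card * ((1 + (ε s)⁻¹) * (435 * (((((P.d + 2) * P.L : ℕ) : ℝ) ^ 2 / 4) * a s) ^ 2) ^ 2)) := by
  -- the level energies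
  set E : ℕ → ℝ := fun s =>
    ∑ p ∈ R s, dist1 (GaugeField.plaqHol (Averaging.iter (fun _ => BlockAveraging.blockAvg (expMeanLogSU (n := n))) s U) p) ^ 2
    with hE
  set α : ℕ → ℝ := fun s => (1 + ε s) * ((P.L : ℝ) ^ 4 * ((P.L : ℝ) ^ P.d)⁻¹) with hαdef
  set c : ℕ → ℝ := fun s =>
    (R (s + 1)).card * ((1 + (ε s)⁻¹) * (435 * (((((P.d + 2) * P.L : ℕ) : ℝ) ^ 2 / 4) * a s) ^ 2) ^ 2) with hc
  have hα : ∀ s, 0 ≤ α s := fun s => by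
    have := hε s
    simp only [hαdef]
    positivity
  have hstep : ∀ s, s < j → E (s + 1) ≤ α s * E s + c s := by
    intro s hs
    have hs1 : s + 1 ≤ P.m + P.K := by omega
    have h := sum_dist1_sq_avgFun_le (n := n) hs1 (ha s hs) (hU s hs) (ht s hs) (hδ s hs) (hε s) (R (s + 1)) (R s) (hR s hs)
    simp only [hE, hαdef, hc, iter_succ_eq]
    exact h
  have hmain := seq_bound_of_step E α c hα j hstep
  have hE0 : E 0 = ∑ q ∈ R 0, dist1 (GaugeField.plaqHol U q) ^ 2 := rfl
  rw [hE0] at hmain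
  simpa only [hE, hαdef, hc] using hmain

end Iter

end Summit.QuantumFields.YangMills.Theorems.HistoryTailStokesIter

end
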